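import Mathlib
import Summits.Ventures.PercRepro.TriangleCapThreeRowLocusPieces

/-!
# PercRepro — THE EQUALITY LOCUS OF THE DIAGONAL AT SECOND ORDER ON THE ROW `a = 3`: a `K₄⁻`-free graph with
`3 (k − 3)` edges on `k ≥ 8` vertices that is not `3`-bipartite attains the second-best value
`Σ_v d(v)² + 6 (k − 7) = m k` iff it is `K_{4,k−4}` minus a `(k − 7)`-star — EXCEPT at `k = 9`, where `K_{4,4}` with
a vertex hung on an edge (one triangle, degrees `5 5 4 4 4 4 4 4 2`) also attains it (p3, gen 44; part 197d)

Part 197b's equality tracking on the induction of §10bu(e) with the pieces of part 197c: the cap and the row-`4`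
convexity are excluded, the cross-row deletion gives `4`-bipartite or, at `k = 9`, the hung `K_{4,4}`
(`three_cross_eq`), and the within-row deletion of a vertex of degree `3` has `D − z = K_{3,k−4}` (the neighbours of
`z` on the large side) or `D − z` at the second-best value of `k − 1` with the neighbours of `z` at `k − 5`: by the
locus at `k − 1`, `D − z` is `K_{4,k−5}` minus a `(k − 8)`-star — the neighbours on its `4`-side by degree for
`k ≥ 10`, by `K₄⁻`-freeness at `k = 9` where they are complete to the other side (`three_within_nine_sides`) — or,
at `k = 10`, the hung `K_{4,4}`, impossible (three neighbours of degree `5`). `three_diag_second_locus (10 ≤ k)`,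
`three_diag_second_locus_nine`, `three_diag_second_locus_eight`. Axioms: standard.
-/

namespace PercRepro

namespace TriangleCap

namespace C047

open Finset

universe u

variable {V : Type*} [Fintype V] [DecidableEq V]

/-- The neighbours of `z` on one side of `D − z = K_{4,4}` minus a star (at `k = 9`, every neighbour of degree `4`,
hence complete to the other side). -/
theorem three_within_nine_sides (D : SimpleGraph V) [DecidableRel D.Adj] (hK : K4mFree D) (z : V)
    (hk'' : Fintype.card {v : V // v ≠ z} = 8) (A'' : Finset {v : V // v ≠ z}) (hA''card : A''.card = 4)
    (hA'' : BipSub (del D z) A'') (hd : deg D z = 3)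
    (hdeg : ∀ w : {v : V // v ≠ z}, D.Adj w.1 z → deg (del D z) w = 4) :
    ∃ A : Finset V, A.card = 4 ∧ BipSub D A := by
  have hfull : ∀ w : {v : V // v ≠ z}, D.Adj w.1 z →
      ∀ u : {v : V // v ≠ z}, (w ∈ A'' ↔ u ∉ A'') → (del D z).Adj w u := by
    intro w hw u hu
    by_cases hwA : w ∈ A''
    · have huA : u ∈ A''ᶜ := mem_compl.mpr (hu.mp hwA)
      have h := adj_of_deg_eq_card_of_bipSub (del D z) A''ᶜ (bipSub_compl (del D z) A'' hA'') w
        (by rw [mem_compl, not_not]; exact hwA) (by rw [hdeg w hw, card_compl, hA''card, hk'']) u huA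
      exact h
    · have huA : u ∈ A'' := by tauto
      exact adj_of_deg_eq_card_of_bipSub (del D z) A'' hA'' w hwA (by rw [hdeg w hw, hA''card]) u huA
  rcases nbhd_one_side_of_full D hK z A'' hfull (by omega) with hin | hoff
  · obtain ⟨B, hBcard, hB⟩ := bipSub_lift D z A'' hA'' hin
    exact ⟨B, by rw [hBcard, hA''card], hB⟩
  · have hA''c : BipSub (del D z) A''ᶜ := bipSub_compl (del D z) A'' hA''
    obtain ⟨B, hBcard, hB⟩ := bipSub_lift D z A''ᶜ hA''c (fun w hw => mem_compl.mpr (hoff w hw))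
    refine ⟨B, ?_, hB⟩
    rw [hBcard, card_compl, hA''card, hk'']

/-- **THE WITHIN-ROW CASE AT EQUALITY ON THE ROW `a = 3`:** a vertex `z` of degree `3`, `8 ≤ k`, every degree
`≤ k − 4`, `D` not `3`-bipartite, `Σ_v d(v)² + 6 (k − 7) = m k`, given the locus at `k − 1` for `D − z` ⇒ `D` is
`4`-bipartite. -/
theorem three_within_eq (D : SimpleGraph V) [DecidableRel D.Adj] (hK : K4mFree D)
    (hk : 8 ≤ Fintype.card V) (hm : D.edgeFinset.card + 9 = 3 * Fintype.card V)
    (hcap : ∀ v, deg D v + 4 ≤ Fintype.card V) (z : V) (hz : deg D z = 3)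
    (hnb : ¬ ∃ A : Finset V, A.card = 3 ∧ BipSub D A)
    (heq : ∑ v, deg D v * deg D v + 6 * (Fintype.card V - 7) = D.edgeFinset.card * Fintype.card V)
    (hIH : 8 ≤ Fintype.card {v : V // v ≠ z} →
      ¬ (∃ A' : Finset {v : V // v ≠ z}, A'.card = 3 ∧ BipSub (del D z) A') →
      ∑ w : {v : V // v ≠ z}, deg (del D z) w * deg (del D z) w + 6 * (Fintype.card {v : V // v ≠ z} - 7) =
        (del D z).edgeFinset.card * Fintype.card {v : V // v ≠ z} →
      (∃ (A'' : Finset {v : V // v ≠ z}) (v : {v : V // v ≠ z}), A''.card = 4 ∧ BipSub (del D z) A'' ∧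
        MissingStar (del D z) A'' v) ∨ (Fintype.card {v : V // v ≠ z} = 9 ∧ HungK44 (del D z))) :
    ∃ A : Finset V, A.card = 4 ∧ BipSub D A := by
  have hK' := k4mFree_del D hK z
  have hcard' := card_del z
  have hedges' := card_edges_del D z
  rw [hz] at hedges'
  obtain ⟨k, hk'⟩ : ∃ k, Fintype.card V = k := ⟨_, rfl⟩
  have hk'' : Fintype.card {v : V // v ≠ z} = k - 1 := by omega
  rw [hk'] at hk hm heq
  have hm' : (del D z).edgeFinset.card + 9 = 3 * Fintype.card {v : V // v ≠ z} := by rw [hk'']; omega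
  have hm'0 : (del D z).edgeFinset.card + 0 = 3 * (Fintype.card {v : V // v ≠ z} - 3) := by rw [hk'']; omega
  by_cases hbip : ∃ A' : Finset {v : V // v ≠ z}, A'.card = 3 ∧ BipSub (del D z) A'
  · obtain ⟨A', hA'card, hA'⟩ := hbip
    rcases nbhd_one_side_of_bipSub D hK z A' 3 0 hA'card hA' hm'0 (by omega) with hin | hoff
    · exfalso
      obtain ⟨B, hBcard, hB⟩ := bipSub_lift D z A' hA' hin
      exact hnb ⟨B, by rw [hBcard, hA'card], hB⟩
    · obtain ⟨A, hAcard, hA⟩ := bipSub_insert_of_nbhd_off D z A' hA' hoff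
      exact ⟨A, by rw [hAcard, hA'card], hA⟩
  · -- the gap case
    have hsq := sum_deg_sq_del D z
    have hT := sum_del_nbhd_le D z (Fintype.card V - 3 - 2) (fun v => by have := hcap v; omega)
    rw [hz] at hsq hT
    rcases diag_second_order (del D z) hK' (by omega) hm' with h | hgap
    · exact absurd h hbip
    obtain ⟨T, hTdef⟩ : ∃ T, ∑ w : {v : V // v ≠ z}, (if D.Adj w.1 z then deg (del D z) w else 0) = T := ⟨_, rfl⟩
    obtain ⟨S', hS'def⟩ : ∃ S', ∑ w : {v : V // v ≠ z}, deg (del D z) w * deg (del D z) w = S' := ⟨_, rfl⟩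
    obtain ⟨m', hm'def⟩ : ∃ m', (del D z).edgeFinset.card = m' := ⟨_, rfl⟩
    rw [hTdef, hS'def] at hsq
    rw [hTdef, hk'] at hT
    rw [hS'def, hm'def, hk''] at hgap
    rw [hm'def] at hedges'
    rw [hsq, ← hedges'] at heq
    obtain ⟨c, hc⟩ : ∃ c, k = 8 + c := ⟨k - 8, by omega⟩
    subst hc
    have e1 : 8 + c - 1 - 7 = c := by omega
    have e2 : 8 + c - 1 = 7 + c := by omega
    have e3 : 8 + c - 3 - 2 = 3 + c := by omega
    have e4 : 8 + c - 7 = c + 1 := by omega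
    rw [e1, e2] at hgap
    rw [e3] at hT
    rw [e4] at heq
    rw [e2] at hk''
    have hm1 : m' = 3 * (3 + 1 + c) := by omega
    clear hsq hm hm' hm'0 hcard'
    obtain ⟨hS'eq, hTeq'⟩ := diag_within_eq_gap 3 c m' S' T hm1 (by simpa using hgap) hT (by
      have e : 2 * 3 * (c + 1) = 6 * (c + 1) := by ring
      rw [e]; exact heq)
    have hdeg : ∀ w : {v : V // v ≠ z}, D.Adj w.1 z → deg (del D z) w = 3 + c :=
      deg_del_eq_of_sum_eq D z (3 + c) (fun v => by have := hcap v; omega) (by rw [hTdef, hTeq', hz])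
    clear hT hTdef hTeq' heq hgap hcap
    rcases Nat.eq_zero_or_pos c with hc0 | hc1
    · -- `k = 8`: `D − z` at the Mantel envelope on `7` vertices is `K_{3,4}`
      exfalso
      subst hc0
      simp only [mul_zero, add_zero] at hS'eq hk''
      have hm'' : (del D z).edgeFinset.card + 3 * 3 + 0 = 3 * Fintype.card {v : V // v ≠ z} := by
        rw [hm'def, hk'', hm1]
      obtain ⟨A', -, hA'card, hA', -⟩ := (closed_form_eq_iff (del D z) hK' 3 0 (by omega) (by omega)
        (by omega) hm'').mp (by
          rw [hS'def, hm'def, hk'']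
          simp only [zero_mul, add_zero]
          rw [hS'eq])
      exact hbip ⟨A', hA'card, hA'⟩
    · -- `k ≥ 9`: the locus at `k − 1`
      have e6 : 7 + c - 7 = c := by omega
      rcases hIH (by omega) hbip (by rw [hS'def, hm'def, hk'', e6]; simpa using hS'eq) with
        ⟨A'', v, hA''card, hA'', -⟩ | ⟨hk9, hhung⟩
      · rcases Nat.lt_or_ge 1 c with hc2 | hc1'
        · -- `k ≥ 10`: a vertex off `A''` has degree `≤ 4 < 3 + c`
          have hin : ∀ w : {v : V // v ≠ z}, D.Adj w.1 z → w ∈ A'' := by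
            intro w hw
            by_contra hwA
            have h1 := deg_le_card_of_bipSub (del D z) A'' hA'' w hwA
            have h2 := hdeg w hw
            omega
          obtain ⟨B, hBcard, hB⟩ := bipSub_lift D z A'' hA'' hin
          exact ⟨B, by rw [hBcard, hA''card], hB⟩
        · -- `k = 9`: the neighbours of `z`, of degree `4`, are complete to the other side
          have hc1'' : c = 1 := by omega
          subst hc1''
          exact three_within_nine_sides D hK z hk'' A'' hA''card hA'' hz (fun w hw => by rw [hdeg w hw])
      · -- `k = 10` and `D − z` the hung `K_{4,4}`: three neighbours of degree `5` — impossible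
        exfalso
        have hc2 : c = 2 := by omega
        subst hc2
        have h := hungK44_card_deg_five (del D z) hk9 hhung (univ.filter (fun w : {v : V // v ≠ z} => D.Adj w.1 z))
          (fun w hw => by rw [mem_filter] at hw; exact hdeg w hw.2)
        rw [card_nbhd_del, hz] at h
        omega

/-- **THE LOCUS ON THE ROW `a = 3`, EVERY VERTEX TYPE, BY INDUCTION ON `k`:** `K₄⁻`-free, `8 ≤ k`, `m + 9 = 3k`, not
`3`-bipartite, `Σ_v d(v)² + 6 (k − 7) = m k` ⇒ `K_{4,k−4}` minus a `(k − 7)`-star, or `k = 9` and the hung `K_{4,4}`. -/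
theorem three_diag_locus_aux (n : ℕ) :
    ∀ (W : Type u) [Fintype W] [DecidableEq W] (D : SimpleGraph W) [DecidableRel D.Adj], Fintype.card W = n →
      K4mFree D → 8 ≤ Fintype.card W → D.edgeFinset.card + 9 = 3 * Fintype.card W →
      ¬ (∃ A : Finset W, A.card = 3 ∧ BipSub D A) →
      ∑ v, deg D v * deg D v + 6 * (Fintype.card W - 7) = D.edgeFinset.card * Fintype.card W →
      (∃ (A : Finset W) (v : W), A.card = 4 ∧ BipSub D A ∧ MissingStar D A v) ∨
        (Fintype.card W = 9 ∧ HungK44 D) := by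
  refine Nat.strong_induction_on n ?_
  intro n ih W _ _ D _ hn hK hk hm hnb heq
  have hA : (∃ A : Finset W, A.card = 4 ∧ BipSub D A) ∨ (Fintype.card W = 9 ∧ HungK44 D) := by
    -- (A) no vertex at the cap
    by_cases hx : ∃ x, deg D x + 3 = Fintype.card W
    · obtain ⟨x, hx⟩ := hx
      rcases three_row_cap D hK 0 (by omega) (by omega) x hx with h | ⟨h1, -⟩
      · exact absurd h hnb
      · omega
    push Not at hx
    have hcap : ∀ v, deg D v + 3 ≤ Fintype.card W := fun v =>
      deg_add_le_card_of_dense D hK 3 (by norm_num) (by omega)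
        (cap_arith 3 (Fintype.card W) D.edgeFinset.card 0 (by norm_num) (by omega) (by omega)) v
    have hcap' : ∀ v, deg D v + 4 ≤ Fintype.card W := fun v => by
      have h1 := hcap v
      have h2 := hx v
      omega
    -- (B) the convexity of the row `4` is strict
    by_cases hdeg : ∀ v, 4 ≤ deg D v
    · exfalso
      have h := diag_convex D (by omega) hm hcap' hdeg
      have h2 : 6 * (Fintype.card W - 7) < Fintype.card W * (Fintype.card W - 7) :=
        Nat.mul_lt_mul_of_pos_right (by omega) (by omega)
      omega
    push Not at hdeg
    obtain ⟨z, hz⟩ := hdeg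
    rcases Nat.lt_or_ge (deg D z) 3 with hz1 | hz2
    · exact three_cross_eq D hK hk hm hcap' z (by omega) heq
    · have hz3 : deg D z = 3 := by omega
      left
      exact three_within_eq D hK hk hm hcap' z hz3 hnb heq (fun h1 h2 h3 =>
        ih (Fintype.card {v : W // v ≠ z}) (by have := card_del z; omega) {v : W // v ≠ z} (del D z) rfl
          (k4mFree_del D hK z) h1 (by have := card_del z; have := card_edges_del D z; rw [hz3] at this; omega)
          h2 h3)
  rcases hA with ⟨A, hAcard, hA⟩ | h
  · left
    have hmA : D.edgeFinset.card + (Fintype.card W - 7) = 4 * (Fintype.card W - 4) := by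
      have := below_bip_edges 3 0 (Fintype.card W) D.edgeFinset.card (by omega) (by omega)
      rw [add_zero] at this
      have e : Fintype.card W - 2 * 3 - 1 = Fintype.card W - 7 := by omega
      rw [e] at this
      exact this
    have heq' : ∑ v, deg D v * deg D v + (Fintype.card W - 7) *
        (Fintype.card W - 1 - (Fintype.card W - 7)) = D.edgeFinset.card * Fintype.card W := by
      have e : (Fintype.card W - 7) * (Fintype.card W - 1 - (Fintype.card W - 7)) = 6 * (Fintype.card W - 7) := by
        have e2 : Fintype.card W - 1 - (Fintype.card W - 7) = 6 := by omega
        rw [e2, mul_comm]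
      rw [e]; exact heq
    obtain ⟨v, hv⟩ := exists_missingStar_of_closed_form_eq D A hA 4 (Fintype.card W - 7) hAcard hmA (by omega) heq'
    exact ⟨A, v, hAcard, hA, hv⟩
  · exact Or.inr h

/-- **THE EQUALITY LOCUS OF THE DIAGONAL AT SECOND ORDER ON THE ROW `a = 3`, `k ≥ 10`:** `K₄⁻`-free, `m + 9 = 3k`, not
`3`-bipartite, `Σ_v d(v)² + 6 (k − 7) = m k` ⇒ `K_{4,k−4}` minus a `(k − 7)`-star. -/
theorem three_diag_second_locus (D : SimpleGraph V) [DecidableRel D.Adj] (hK : K4mFree D)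
    (hk : 10 ≤ Fintype.card V) (hm : D.edgeFinset.card + 9 = 3 * Fintype.card V)
    (hnb : ¬ ∃ A : Finset V, A.card = 3 ∧ BipSub D A)
    (heq : ∑ v, deg D v * deg D v + 6 * (Fintype.card V - 7) = D.edgeFinset.card * Fintype.card V) :
    ∃ (A : Finset V) (v : V), A.card = 4 ∧ BipSub D A ∧ MissingStar D A v := by
  rcases three_diag_locus_aux (Fintype.card V) V D rfl hK (by omega) hm hnb heq with h | ⟨h9, -⟩
  · exact h
  · omega

/-- **THE CELL `(9, 18)`:** the non-`3`-bipartite `K₄⁻`-free graphs on `9` vertices with `18` edges at the second-best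
value `150` are `K_{4,5}` minus a `2`-star or the hung `K_{4,4}`. -/
theorem three_diag_second_locus_nine (D : SimpleGraph V) [DecidableRel D.Adj] (hK : K4mFree D)
    (hk : Fintype.card V = 9) (hm : D.edgeFinset.card = 18)
    (hnb : ¬ ∃ A : Finset V, A.card = 3 ∧ BipSub D A) (heq : ∑ v, deg D v * deg D v = 150) :
    (∃ (A : Finset V) (v : V), A.card = 4 ∧ BipSub D A ∧ MissingStar D A v) ∨ HungK44 D := by
  rcases three_diag_locus_aux (Fintype.card V) V D rfl hK (by omega) (by omega) hnb (by rw [hk, hm, heq]) with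
    h | ⟨-, h⟩
  · exact Or.inl h
  · exact Or.inr h

/-- **THE CELL `(8, 15)`:** the non-`3`-bipartite `K₄⁻`-free graphs on `8` vertices with `15` edges at the second-best
value `114` are `K_{4,4}` minus an edge. -/
theorem three_diag_second_locus_eight (D : SimpleGraph V) [DecidableRel D.Adj] (hK : K4mFree D)
    (hk : Fintype.card V = 8) (hm : D.edgeFinset.card = 15)
    (hnb : ¬ ∃ A : Finset V, A.card = 3 ∧ BipSub D A) (heq : ∑ v, deg D v * deg D v = 114) :
    ∃ (A : Finset V) (v : V), A.card = 4 ∧ BipSub D A ∧ MissingStar D A v := by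
  rcases three_diag_locus_aux (Fintype.card V) V D rfl hK (by omega) (by omega) hnb (by rw [hk, hm, heq]) with
    h | ⟨h9, -⟩
  · exact h
  · omega

end C047

end TriangleCap

end PercRepro
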